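import Summits.BirchSwinnertonDyer.BirchSwinnertonDyer.Theorems.CumulativeHeegnerLeopoldtRedSplitControlAtThreeShaTwoAssembly
import Summits.BirchSwinnertonDyer.BirchSwinnertonDyer.Theorems.ThetaPartnerAtTwoSignedControlAtTwoMuRealUnramifiedAE
import Literature.NumberTheory.GaloisRepresentations.HomDualShaTwoConnecting
import Literature.NumberTheory.GaloisRepresentations.HomDualShaTwoExhaustion
import HarnessLib

/-!
# Poitou–Tate, degree two: the `Ш²`-readout road run with the NATIVE obstruction map — hypotheses (d) `Ψ h ∈ Ш²` and
# `hS₀` DISCHARGED; `poitouTate_sha_tateDual K` for `K` totally complex from the doors' degree-`≤ 1` package and (e) alone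

Cell `bsd-wall`, seat `bsd-line-chl-p2` g7 (width prover on crux K4 `RedSplitControlAtThree`, stmt-BirchSwinnertonDyer-24200;
stub `stub_poitouTateShaTateDual` = `poitouTate_sha_tateDual K`, item 20462; the K4 closer
`RedSplitControlAtThreeOfFacts.redSplitControlAtThree_of_poitouTate_totallyComplex` consumes `∀ K` totally complex,
`poitouTate_selmerStructure_duality K ∧ poitouTate_sha_tateDual K`).  Sequel of `…ShaTwoAssembly` (g6:
`poitouTate_sha_tateDual_of_shaTwoObstruction`, with the Ext-defined `Ψ = HomDual.shaTwoObstruction'` and the two open inputs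
(d) `Ψ h ∈ Ш²(K, M₀^D)`, (e) `Ш² ⊆ Im Ψ`, besides `hS₀`) and of `Literature/…/HomDualShaTwoConnecting` (g7: the NATIVE map
`Ψ' = HomDual.shaTwoConnecting ρ₀ n hM = H²(e⁻¹) ∘ δ₁^{Hom(S, K̄ˣ)} ∘ δ₀^{Hom(N₁, T)}` on continuous cochains, with (a), (b), (c)
AND (d) PROVED — (d) at every place carrying an idèle projection, by `IsSES.map_res_δ₁` + the coboundary `π_v ∘ h̃`).

* §1 `shaTwo_tateDual_of_shaTwoConnecting` — road B (`shaTwo_tateDual_of_ideleProjection`) with `Ψ := shaTwoConnecting ρ₀ n hM`: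
  (a)(b)(c)(d) discharged by the Literature theorems, the ramification set `S₀` produced inside
  (`SignedEC.MuReal.exists_finset_place_isUnramifiedAt`), `Ш¹(K, M₀^{DD})` finite inside (`finite_sha_of_isUnramifiedOutside`);
  what remains displayed is the doors' degree-`≤ 1` package (Tate duality record — landed —, `π` with (R3), `nat` with (R4) in
  equality form, `SelmerComplement` of the canonical invariant maps) and **(e) `Ш²(K, M₀^D) ⊆ Im Ψ'`** alone.
* §2 **`poitouTate_sha_tateDual_of_shaTwoConnecting`** — THE NAMED FACT `poitouTate_sha_tateDual K` (Milne I Thm. 4.10 (a)) for a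
  TOTALLY COMPLEX `K` from the same inputs quantified over all levels, via g6's biduality transport; compared with g6's
  `poitouTate_sha_tateDual_of_shaTwoObstruction` the hypotheses `hS₀` and `hΨsha` are GONE.

HONEST FRAMING: THEOREMS ONLY; a reduction — (R3)/(R4)/`nat` (cell `bsd-schneider`), `SelmerComplement` (= `hE`) and (e) are
genuine displayed hypotheses; closes no item; no case of Poitou–Tate or BSD is proved here.

References: [MilneADT2006] I Thm. 4.10 (a) and its proof (p. 58), Lemma 4.8, Lemma 4.13, Prop. 0.19; [Harari2020] Thm. 17.13 (b);
[NeukirchSchmidtWingberg2008] (1.3.2), (1.5.2); [SerreAbelianLadic1968] Ch. I §2.1.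
-/

noncomputable section

open Function NumberField IsDedekindDomain CategoryTheory CategoryTheory.Abelian
open scoped NumberField ContRepresentation

set_option linter.dupNamespace false
set_option autoImplicit false

namespace Summit.BirchSwinnertonDyer.BirchSwinnertonDyer.Theorems.PoitouTateShaTwoReadout

open Field
open Literature.NumberTheory.GaloisRepresentations Literature.NumberTheory.GaloisCohomology
open Literature.NumberTheory.GaloisRepresentations.DiscreteGaloisModule (TateDual tateDual localTatePairingZMod
  unramifiedSubgroup sha shaTwo SelmerStructure mem_sha_iff mem_shaTwo_iff)
open Literature.Algebra.Homology Literature.Algebra.Homology.DiscreteRep Literature.Algebra.Homology.ExtPresentation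
open Literature.NumberTheory.GaloisRepresentations.IdeleClassBar (classBarD)
open Literature.AnabelianGeometry.AbsoluteAnabelian.Prop121vii (zmodToQmodZ)
open Literature.NumberTheory.GaloisRepresentations.FreePresentation (presentationComplex presentationComplex_shortExact)
open Literature.NumberTheory.GaloisRepresentations.HomDual (IdeleProjection readout shaTwoConnecting shaTwoConnecting_comp_g'
  shaTwoConnecting_f_comp exists_comp_g_eq_of_shaTwoConnecting_eq_zero shaTwoConnecting_mem_shaTwo)
open Summit.BirchSwinnertonDyer.BirchSwinnertonDyer.Theorems.SchneiderFreeAdditiveX3.PoitouTateReduction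
  (exists_bidual_intertwining)
open Summit.BirchSwinnertonDyer.BirchSwinnertonDyer.Theorems.SignedEC.MuReal (exists_finset_place_isUnramifiedAt)
open Summit.BirchSwinnertonDyer.Rank1Residual.X11b

/-! ## §1 The road with the NATIVE `Ψ := shaTwoConnecting` plugged in: (a)–(d) and `hS₀` discharged -/

section Plugged

variable {K : Type} [Field K] [NumberField K]

/-- **Milne I Thm. 4.10 (a) at the module `M₀^D`, from the presentation road with the NATIVE obstruction map plugged in.**
For `K` totally complex, `n ≥ 1`, a finite `n`-torsion `ρ₀` on `M₀`: IF Tate duality holds for `(Γ_K, C̄, inv)` (door-c4,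
landed), a family `π` of idèle projections has the (R3) property for the idèle readout, a bijection
`nat : H¹(K, M₀^{DD}) ≅ Ext¹(ℤ, M₀)` satisfies the (R4) identity, the canonical invariant maps satisfy `SelmerComplement` at
level `n`, and (e) the native obstruction map `Ψ' = shaTwoConnecting ρ₀ n hM` EXHAUSTS `Ш²(K, M₀^D)`, THEN `Ш²(K, M₀^D)` is finite
and perfectly paired with `Ш¹(K, M₀^{DD})` into `ℤ/n`.  Properties (a)(b)(c)(d) of `Ψ'` are theorems
(`HomDualShaTwoConnecting`; (d) uses the idèle projections `π`), the ramification set `S₀` is produced inside.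
HONEST FRAMING: a reduction; closes nothing.
[cite: MilneADT2006, Ch. I, Thm. 4.10 (a) (proof, p. 58), Lemma 4.8, Lemma 4.13, Thm. 1.8][cite: Harari2020, Thm. 17.13 (b)] -/
theorem shaTwo_tateDual_of_shaTwoConnecting [IsTotallyComplex K] {n : ℕ} [NeZero n]
    (hcomp : (LocalInvariants.canonical K n).SelmerComplement)
    (inv : Abelian.Ext (triv (Γ := absoluteGaloisGroup K) ℤ) (classBarD K) 2 →+ AddCircle (1 : ℚ))
    (hT : TateDualityHypotheses (classBarD K) inv) (π : ∀ v : Place K, IdeleProjection K v)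
    {M : Type} [AddCommGroup M] [TopologicalSpace M] [DiscreteTopology M] [Finite M] [Finite (TateDual K M n)]
    (ρ₀ : DiscreteGaloisModule K M) (hM : ∀ m : M, n • m = 0)
    (hR3 : ∀ T : Finset (Place K), (∀ w : InfinitePlace K, (Sum.inl w : Place K) ∈ T) →
      (∀ v : HeightOneSpectrum (𝓞 K), (Sum.inr v : Place K) ∉ T →
        ((n : ℕ) : 𝓞 K) ∉ v.asIdeal ∧ GaloisRep.IsUnramifiedAt v (ρ₀.tateDual n)) →
      ∀ t : Π v : Place K, galoisCohomology ((ρ₀.tateDual n).toLocal v) 1,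
        (∀ v : HeightOneSpectrum (𝓞 K), (Sum.inr v : Place K) ∉ T →
          t (Sum.inr v) ∈ unramifiedSubgroup (GaloisRep.toLocal v (ρ₀.tateDual n)) 1) →
        ∃ f : (presentationComplex ρ₀).X₁ ⟶ (ideleClassLimitShortComplex K).X₂,
          ∀ v : Place K, readout ρ₀ n hM (π v) f = t v)
    (nat : galoisCohomology ((ρ₀.tateDual n).tateDual n) 1 →+
      Abelian.Ext (triv (Γ := absoluteGaloisGroup K) ℤ) (presentationComplex ρ₀).X₃ 1)
    (hnat : Function.Bijective nat)
    (hR4 : ∀ f : (presentationComplex ρ₀).X₁ ⟶ (ideleClassLimitShortComplex K).X₂, ∃ Tf : Finset (Place K),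
      ∀ (y : galoisCohomology ((ρ₀.tateDual n).tateDual n) 1) (T' : Finset (Place K)), Tf ⊆ T' →
        (∀ v : HeightOneSpectrum (𝓞 K), (Sum.inr v : Place K) ∉ T' →
          galoisCohomology.localization ((ρ₀.tateDual n).tateDual n) (Sum.inr v) 1 y ∈
            unramifiedSubgroup (GaloisRep.toLocal v ((ρ₀.tateDual n).tateDual n)) 1) →
        zmodToQmodZ n (∑ v ∈ T', localTatePairingZMod (ρ₀.tateDual n) n v (LocalInvariants.canonical K n v)
          (readout ρ₀ n hM (π v) f)
          (galoisCohomology.localization ((ρ₀.tateDual n).tateDual n) v 1 y)) =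
        inv ((nat y).comp (boundary (presentationComplex_shortExact ρ₀) (classBarD K)
          (f ≫ (ideleClassLimitShortComplex K).g)) (rfl : 1 + 1 = 2)))
    (hΨsurj : ∀ c ∈ shaTwo (ρ₀.tateDual n), ∃ h : (presentationComplex ρ₀).X₁ ⟶ classBarD K,
      shaTwoConnecting ρ₀ n hM h = c) :
    Finite (shaTwo (ρ₀.tateDual n)) ∧
      ∃ b : shaTwo (ρ₀.tateDual n) →+ sha ((ρ₀.tateDual n).tateDual n) →+ ZMod n,
        Function.Bijective b ∧ Function.Bijective b.flip := by
  haveI : Finite (TateDual K (TateDual K M n) n) := DiscreteGaloisModule.TateDual.finite K _ n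
  -- the ramification set of `M₀^D` and the finiteness of `Ш¹(K, M₀^{DD})` are theorems
  obtain ⟨S₀, hinf, hS₀⟩ := exists_finset_place_isUnramifiedAt (ρ₀.tateDual n) n
  obtain ⟨S₁, hinf₁, hS₁⟩ := exists_finset_place_isUnramifiedAt ((ρ₀.tateDual n).tateDual n) n
  haveI : Finite (sha ((ρ₀.tateDual n).tateDual n)) :=
    finite_sha_of_isUnramifiedOutside _ S₁ hinf₁ fun v hv => (hS₁ v hv).2
  exact shaTwo_tateDual_of_ideleProjection hcomp inv hT π ρ₀ hM S₀ hinf hS₀ hR3 nat hnat hR4 (shaTwoConnecting ρ₀ n hM)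
    (fun f => shaTwoConnecting_comp_g' ρ₀ n hM f) (shaTwoConnecting_f_comp ρ₀ n hM)
    (exists_comp_g_eq_of_shaTwoConnecting_eq_zero ρ₀ n hM) (shaTwoConnecting_mem_shaTwo ρ₀ n hM π) hΨsurj

end Plugged

/-! ## §2 The named fact `poitouTate_sha_tateDual K` for a totally complex `K`, `hS₀` and (d) gone -/

section Assembly

variable {K : Type} [Field K] [NumberField K]

/-- **THE NAMED FACT `poitouTate_sha_tateDual K` (Milne I Thm. 4.10 (a): `Ш²(K, M)` and `Ш¹(K, M^D)` finite and perfectly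
paired into `ℤ/n`, all `n ≥ 1`, all finite `n`-torsion `M`) for a TOTALLY COMPLEX `K`, from the presentation road of cell
`bsd-schneider` plus the NATIVE degree-`2` obstruction map.**  Inputs, each quantified over all levels `n ≥ 1` and all finite
`n`-torsion modules `M₀`: Tate duality for `(Γ_K, C̄, inv)` (door-c4, landed for `inv = classBarInvD K`); ONE family `π` of idèle
projections with the (R3) property for the idèle readout of the canonical presentation; the bridge `nat` with the (R4) identity;
`SelmerComplement` of the canonical invariant maps (= `hE(n)`); and (e) `Ш²(K, M₀^D) ⊆ Im (shaTwoConnecting ρ₀ n hM)`.  Compared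
with g6's `poitouTate_sha_tateDual_of_shaTwoObstruction`: NO `hS₀` (a theorem, `exists_finset_place_isUnramifiedAt`) and NO (d)
(a theorem for the native map, `shaTwoConnecting_mem_shaTwo`).  The pairing for `M` is transported from the road's pairing for
`(Ш²(K, M^{DD}), Ш¹(K, M^{DDD}))` along the biduality `M ≅ M^{DD}`.  HONEST FRAMING: a reduction with displayed hypotheses; no
case of BSD. [cite: MilneADT2006, Ch. I, Thm. 4.10 (a) (proof, p. 58), Lemma 4.8, Prop. 0.19][cite: Harari2020, Thm. 17.13 (b)] -/
theorem poitouTate_sha_tateDual_of_shaTwoConnecting [IsTotallyComplex K]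
    (hcomp : ∀ (n : ℕ) [NeZero n], (LocalInvariants.canonical K n).SelmerComplement)
    (inv : Abelian.Ext (triv (Γ := absoluteGaloisGroup K) ℤ) (classBarD K) 2 →+ AddCircle (1 : ℚ))
    (hT : TateDualityHypotheses (classBarD K) inv) (π : ∀ v : Place K, IdeleProjection K v)
    (hR3 : ∀ (n : ℕ) [NeZero n],
      ∀ ⦃M : Type⦄ [AddCommGroup M] [TopologicalSpace M] [DiscreteTopology M] [Finite M] [Finite (TateDual K M n)]
      (ρ₀ : DiscreteGaloisModule K M) (hM : ∀ m : M, n • m = 0),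
      ∀ T : Finset (Place K), (∀ w : InfinitePlace K, (Sum.inl w : Place K) ∈ T) →
        (∀ v : HeightOneSpectrum (𝓞 K), (Sum.inr v : Place K) ∉ T →
          ((n : ℕ) : 𝓞 K) ∉ v.asIdeal ∧ GaloisRep.IsUnramifiedAt v (ρ₀.tateDual n)) →
        ∀ t : Π v : Place K, galoisCohomology ((ρ₀.tateDual n).toLocal v) 1,
          (∀ v : HeightOneSpectrum (𝓞 K), (Sum.inr v : Place K) ∉ T →
            t (Sum.inr v) ∈ unramifiedSubgroup (GaloisRep.toLocal v (ρ₀.tateDual n)) 1) →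
          ∃ f : (presentationComplex ρ₀).X₁ ⟶ (ideleClassLimitShortComplex K).X₂,
            ∀ v : Place K, readout ρ₀ n hM (π v) f = t v)
    (hR4 : ∀ (n : ℕ) [NeZero n],
      ∀ ⦃M : Type⦄ [AddCommGroup M] [TopologicalSpace M] [DiscreteTopology M] [Finite M] [Finite (TateDual K M n)]
      (ρ₀ : DiscreteGaloisModule K M) (hM : ∀ m : M, n • m = 0),
      ∃ nat : galoisCohomology ((ρ₀.tateDual n).tateDual n) 1 →+
          Abelian.Ext (triv (Γ := absoluteGaloisGroup K) ℤ) (presentationComplex ρ₀).X₃ 1,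
        Function.Bijective nat ∧
        ∀ f : (presentationComplex ρ₀).X₁ ⟶ (ideleClassLimitShortComplex K).X₂, ∃ Tf : Finset (Place K),
          ∀ (y : galoisCohomology ((ρ₀.tateDual n).tateDual n) 1) (T' : Finset (Place K)), Tf ⊆ T' →
            (∀ v : HeightOneSpectrum (𝓞 K), (Sum.inr v : Place K) ∉ T' →
              galoisCohomology.localization ((ρ₀.tateDual n).tateDual n) (Sum.inr v) 1 y ∈
                unramifiedSubgroup (GaloisRep.toLocal v ((ρ₀.tateDual n).tateDual n)) 1) →
            zmodToQmodZ n (∑ v ∈ T', localTatePairingZMod (ρ₀.tateDual n) n v (LocalInvariants.canonical K n v)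
              (readout ρ₀ n hM (π v) f)
              (galoisCohomology.localization ((ρ₀.tateDual n).tateDual n) v 1 y)) =
            inv ((nat y).comp (boundary (presentationComplex_shortExact ρ₀) (classBarD K)
              (f ≫ (ideleClassLimitShortComplex K).g)) (rfl : 1 + 1 = 2)))
    (hΨsurj : ∀ (n : ℕ) [NeZero n],
      ∀ ⦃M : Type⦄ [AddCommGroup M] [TopologicalSpace M] [DiscreteTopology M] [Finite M]
      (ρ₀ : DiscreteGaloisModule K M) (hM : ∀ m : M, n • m = 0),
        ∀ c ∈ shaTwo (ρ₀.tateDual n), ∃ h : (presentationComplex ρ₀).X₁ ⟶ classBarD K,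
          shaTwoConnecting ρ₀ n hM h = c) :
    poitouTate_sha_tateDual K := by
  intro n _ M _ _ _ _ ρ hM
  haveI : Finite (TateDual K M n) := DiscreteGaloisModule.TateDual.finite K M n
  haveI : Finite (TateDual K (TateDual K M n) n) := DiscreteGaloisModule.TateDual.finite K _ n
  haveI : Finite (TateDual K (TateDual K (TateDual K M n) n) n) := DiscreteGaloisModule.TateDual.finite K _ n
  -- the module to present: `ρ₀ := ρ^D`, so that the road speaks about `Ш²(ρ^{DD})` and `Ш¹(ρ^{DDD})`
  set ρ₀ : DiscreteGaloisModule K (TateDual K M n) := ρ.tateDual n with hρ₀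
  have hM₀ : ∀ m : TateDual K M n, n • m = 0 := fun m => DiscreteGaloisModule.TateDual.nsmul_eq_zero m
  -- finiteness of `Ш¹(K, M^D)`
  obtain ⟨S₂, hinf₂, hS₂⟩ := exists_finset_place_isUnramifiedAt (ρ.tateDual n) n
  haveI hfin1 : Finite (sha (ρ.tateDual n)) :=
    finite_sha_of_isUnramifiedOutside _ S₂ hinf₂ fun v hv => (hS₂ v hv).2
  -- the road at `ρ₀`
  obtain ⟨nat, hnat, hR4'⟩ := hR4 n ρ₀ hM₀
  obtain ⟨hfin2', b, hb, hbflip⟩ := shaTwo_tateDual_of_shaTwoConnecting (hcomp n) inv hT π ρ₀ hM₀ (hR3 n ρ₀ hM₀) nat hnat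
    hR4' (hΨsurj n ρ₀ hM₀)
  -- biduality `M ≅ M^{DD}` and `M^D ≅ M^{DDD}`
  obtain ⟨ι, κ, -, hκι, hικ⟩ := exists_bidual_intertwining (n := n) ρ hM
  obtain ⟨ι', κ', -, hκι', hικ'⟩ := exists_bidual_intertwining (n := n) (ρ.tateDual n) hM₀
  obtain ⟨eA⟩ : Nonempty (shaTwo ρ ≃+ shaTwo (ρ₀.tateDual n)) := nonempty_shaTwo_addEquiv ι κ hκι hικ
  obtain ⟨eB⟩ : Nonempty (sha (ρ.tateDual n) ≃+ sha ((ρ₀.tateDual n).tateDual n)) :=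
    nonempty_sha_addEquiv ι' κ' hκι' hικ'
  haveI := hfin2'
  obtain ⟨b', -, hb', hb'flip⟩ := exists_perfect_of_addEquiv eA eB b hb hbflip
  exact ⟨hfin1, Finite.of_equiv _ eA.toEquiv.symm, b', hb', hb'flip⟩

end Assembly

/-! ## §3 (appended, g7) `poitouTate_sha_tateDual K` from the doors' package and Milne I Lemma 4.13 in the forms (A), (B) -/

section LocalGlobal

variable {K : Type} [Field K] [NumberField K]

open Literature.NumberTheory.GaloisRepresentations.HomDual (exists_shaTwoConnecting_eq_of_localGlobal dualF homF postcompResHom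
  unitsTransfer unitsToIdeleI)
open Literature.NumberTheory.GaloisRepresentations.FreePresentation (presModule₁ presModule₂ presProj moduleFinite_presModule₁
  moduleFinite_presModule₂)
open Literature.NumberTheory.GaloisRepresentations.DGMBridge (toDGM)
open Literature.NumberTheory.GaloisRepresentations.DiscreteGaloisModule (units)

/-- **THE NAMED FACT `poitouTate_sha_tateDual K` for a TOTALLY COMPLEX `K`, with (e) replaced by Milne I Lemma 4.13 in the two
Lean-typed forms (A), (B) of `HomDual.exists_shaTwoConnecting_eq_of_localGlobal`.**  Inputs, over all levels `n ≥ 1` and all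
finite `n`-torsion `M₀`: the doors' degree-`≤ 1` package (Tate duality record for `(Γ_K, C̄, inv)` — landed —, ONE family `π`
of idèle projections with (R3), the bridge `nat` with (R4), `SelmerComplement` of the canonical invariant maps), and
(A) for `c ∈ Ш²(K, M₀^D)` the class `H²(p^*)(H²(e) c) ∈ H²(K, Hom_ℤ(P, K̄ˣ))` vanishes (local–global principle for
`H²(K, Hom(P, K̄ˣ)) ≅ Br(K(M₀))^{|M₀|}`: Brauer–Hasse–Noether + Shapiro), (B) a class of `H¹(K, Hom_ℤ(N₁, K̄ˣ))` whose transfers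
to all completions vanish dies in `H¹(K, Hom_ℤ(N₁, J̄))` (Milne I 4.13 in degree `1` for the relation lattice).  Everything in
degree `2` that is NOT one of these two classical local–global statements is a theorem ((a)–(d), the ramification set, the
finiteness of `Ш¹`, the biduality transport).  HONEST FRAMING: a reduction; (A), (B), (R3), (R4), `SelmerComplement` are
displayed hypotheses; no case of BSD. [cite: MilneADT2006, Ch. I, Thm. 4.10 (a) (proof, p. 58), Lemma 4.13, Lemma 4.8]
[cite: CasselsFrohlichANT1967, Ch. VII §9.6, §10, §11.1][cite: Harari2020, Thm. 17.13 (b)] -/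
theorem poitouTate_sha_tateDual_of_localGlobal [IsTotallyComplex K]
    (hcomp : ∀ (n : ℕ) [NeZero n], (LocalInvariants.canonical K n).SelmerComplement)
    (inv : Abelian.Ext (triv (Γ := absoluteGaloisGroup K) ℤ) (classBarD K) 2 →+ AddCircle (1 : ℚ))
    (hT : TateDualityHypotheses (classBarD K) inv) (π : ∀ v : Place K, IdeleProjection K v)
    (hR3 : ∀ (n : ℕ) [NeZero n],
      ∀ ⦃M : Type⦄ [AddCommGroup M] [TopologicalSpace M] [DiscreteTopology M] [Finite M] [Finite (TateDual K M n)]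
      (ρ₀ : DiscreteGaloisModule K M) (hM : ∀ m : M, n • m = 0),
      ∀ T : Finset (Place K), (∀ w : InfinitePlace K, (Sum.inl w : Place K) ∈ T) →
        (∀ v : HeightOneSpectrum (𝓞 K), (Sum.inr v : Place K) ∉ T →
          ((n : ℕ) : 𝓞 K) ∉ v.asIdeal ∧ GaloisRep.IsUnramifiedAt v (ρ₀.tateDual n)) →
        ∀ t : Π v : Place K, galoisCohomology ((ρ₀.tateDual n).toLocal v) 1,
          (∀ v : HeightOneSpectrum (𝓞 K), (Sum.inr v : Place K) ∉ T →
            t (Sum.inr v) ∈ unramifiedSubgroup (GaloisRep.toLocal v (ρ₀.tateDual n)) 1) →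
          ∃ f : (presentationComplex ρ₀).X₁ ⟶ (ideleClassLimitShortComplex K).X₂,
            ∀ v : Place K, readout ρ₀ n hM (π v) f = t v)
    (hR4 : ∀ (n : ℕ) [NeZero n],
      ∀ ⦃M : Type⦄ [AddCommGroup M] [TopologicalSpace M] [DiscreteTopology M] [Finite M] [Finite (TateDual K M n)]
      (ρ₀ : DiscreteGaloisModule K M) (hM : ∀ m : M, n • m = 0),
      ∃ nat : galoisCohomology ((ρ₀.tateDual n).tateDual n) 1 →+
          Abelian.Ext (triv (Γ := absoluteGaloisGroup K) ℤ) (presentationComplex ρ₀).X₃ 1,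
        Function.Bijective nat ∧
        ∀ f : (presentationComplex ρ₀).X₁ ⟶ (ideleClassLimitShortComplex K).X₂, ∃ Tf : Finset (Place K),
          ∀ (y : galoisCohomology ((ρ₀.tateDual n).tateDual n) 1) (T' : Finset (Place K)), Tf ⊆ T' →
            (∀ v : HeightOneSpectrum (𝓞 K), (Sum.inr v : Place K) ∉ T' →
              galoisCohomology.localization ((ρ₀.tateDual n).tateDual n) (Sum.inr v) 1 y ∈
                unramifiedSubgroup (GaloisRep.toLocal v ((ρ₀.tateDual n).tateDual n)) 1) →
            zmodToQmodZ n (∑ v ∈ T', localTatePairingZMod (ρ₀.tateDual n) n v (LocalInvariants.canonical K n v)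
              (readout ρ₀ n hM (π v) f)
              (galoisCohomology.localization ((ρ₀.tateDual n).tateDual n) v 1 y)) =
            inv ((nat y).comp (boundary (presentationComplex_shortExact ρ₀) (classBarD K)
              (f ≫ (ideleClassLimitShortComplex K).g)) (rfl : 1 + 1 = 2)))
    (hA : ∀ (n : ℕ) [NeZero n],
      ∀ ⦃M : Type⦄ [AddCommGroup M] [TopologicalSpace M] [DiscreteTopology M] [Finite M]
      (ρ₀ : DiscreteGaloisModule K M) (hM : ∀ m : M, n • m = 0),
        haveI := moduleFinite_presModule₂ ρ₀
        ∀ c ∈ shaTwo (ρ₀.tateDual n),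
          cohomologyMap (dualF (presModule₂ ρ₀) ρ₀ (units K) (presProj ρ₀)) 2
            (cohomologyMap (HomDual.tateDualUnitsIso K ρ₀ n hM).hom 2 c) = 0)
    (hB : ∀ (n : ℕ) [NeZero n],
      ∀ ⦃M : Type⦄ [AddCommGroup M] [TopologicalSpace M] [DiscreteTopology M] [Finite M]
      (ρ₀ : DiscreteGaloisModule K M),
        haveI := moduleFinite_presModule₁ ρ₀
        ∀ y : galoisCohomology (homGaloisModule (presModule₁ ρ₀) (units K)) 1,
          (∀ v : Place K, ContinuousCohomology.map (absGaloisRestrict K (Place.Completion v))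
            (postcompResHom (presModule₁ ρ₀) (units K) (units (Place.Completion v)) (unitsTransfer K (Place.Completion v))) 1
              y = 0) →
          cohomologyMap (homF (presModule₁ ρ₀) (units K) (toDGM (ideleBarD K)) (unitsToIdeleI K)) 1 y = 0) :
    poitouTate_sha_tateDual K :=
  poitouTate_sha_tateDual_of_shaTwoConnecting hcomp inv hT π hR3 hR4 fun n _ _ _ _ _ _ ρ₀ hM c hc =>
    exists_shaTwoConnecting_eq_of_localGlobal ρ₀ n hM (hA n ρ₀ hM) (hB n ρ₀) c hc

end LocalGlobal

end Summit.BirchSwinnertonDyer.BirchSwinnertonDyer.Theorems.PoitouTateShaTwoReadout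

end
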